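/-
Origin: expansion seat `prover-pub-hodgecm-mc-sinst-1-g5-0`, handover #1225 2026-08-20T11:03Z md5 1d72a6449d55 (224 l., 5 decls) NEW additive leaf; imports #1224 (this kit) + RUN-48 #P48a ArchConjSlotStrip (period-1); ROWDEPS #1223 #1224; (VT) FROM (STRIP): transport of the product-currency tensor decomposition of ω(r_F h₀) to Fin (3·2) and `exists_reindex_archFactor_eq_smul_cmArchWeilRep_cmConjSeesawMp` (hypothesis = period-1's STRIP clause 2 verbatim); NAME LIST: HodgeCM.Model.ArchLevi.exists_reindex_archFactor_eq_smul_cmArchWeilRep_conj · HodgeCM.Model.ArchLevi.exists_reindex_archFactor_eq_smul_cmArchWeilRep_cmConjSeesawMp · HodgeCM.Model.ArchLevi.proj_conjSeesawMp (`HOME/mc/pub-hodgecm-mc-sinst-1-g5/stage/HodgeCM/Model/ArchConjLeviVT.lean`, md5 1d72a6449d55, 224 lines);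
landed by the second packager p2 gen 7 (p2-g7) in gate run 50 as `HodgeCM/Model/ArchConjLeviVT.lean` (verbatim).
-/
/-
Origin: speedrun cell pub-hodgecm, MODEL-CONSTRUCTION sub-cell, lineage mc-sinst-1 (S-instance constructor, BINDER-OWNERS row 5 `S` / row 6 `μ`: (J-μ) slots 2/3,
(VT) from (STRIP)), seat prover-pub-hodgecm-mc-sinst-1-g5-0 (gen 5), 2026-08-20.
Target in PKG: `HodgeCM/Model/ArchConjLeviVT.lean` (NEW additive leaf; imports sinst `Model/ArchConjLeviShape` (same kit) + period-1's RUN-48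
#P48a `Model/ArchConjSlotStrip`).
KERNEL only: 0 records / `def … : Prop` / cites-as-hypotheses, 0 proof holes; intended closure {propext, Classical.choice, Quot.sound}.
-/
import Summits.HodgeConjecture.HodgeCM.Model.ArchConjLeviShape
import Summits.HodgeConjecture.HodgeCM.Model.ArchConjSlotStrip

/-!
# (VT) FROM (STRIP): the archimedean factor of `ω(r_F h₀)` is `c • ω_∞(1, k) ∘ (· ∘ J_S)` after reindexing

Period-1's (STRIP) leaf `ArchConjSlotStrip` (RUN 48) decomposes `ω(r_F h₀) (E(Φ ⊗ f)) = E(A Φ ⊗ M_f f)` on `𝒮(𝔸^{3 × (1+1)})` for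
`r_F h₀ = cmConjSeesawMp …` (`π(r_F h₀) = h₀ = seesawElement …`).  This leaf transports that decomposition to the `Fin (3·2)` currency of
`cmArchWeilRep` (`adelicMpContReindex`, `adelicMpCont.omega_reindex_apply`, `piSBReindex_tmul`) and applies `ArchConjLeviShape.exists_archFactor_eq_smul_cmArchWeilRep_conj`:

* §6 `proj_reindex_cmConjSeesawMp`; **`exists_reindex_archFactor_eq_smul_cmArchWeilRep_conj`** — for ANY `p ∈ Mp_ψ(W_{T_V ⊗ T_W})ᶜᵒⁿᵗ` over
  `conjSeesawSp` with a tensor decomposition `(A, M_f)` (`Fin 3 × Fin 2` currency):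
  `∃ c, ∀ Φ, R_e (A Φ) = c • cmArchWeilRep hGR (1, conjTransportK S) ((R_e Φ) ∘ J_S)`;
* §7 `conjSeesawMp` (= period-1's `cmConjSeesawMp` read at `Fin 3 × Fin 2`), `proj_conjSeesawMp`, and
  **`exists_reindex_archFactor_eq_smul_cmArchWeilRep_cmConjSeesawMp`** — the same with the hypothesis being VERBATIM clause 2 of period-1's
  `exists_cmConjLineTensorFin_testFun_eq_tmul` (`Fin 3 × Fin (1 + 1)` currency).

So E's `hΔ₂`/`hΔ₃` inputs (#1218 `…_of_strip_vt`, (K10) `hSV`) follow from (STRIP) clause 3 (`hstrip`, `Y = R_e (A (raw primed box))`) and this leaf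
(`hY` with `a := c`, after (K9) `compCLM_conjFrameTransport_slotArchBox_linePhi`: `Φ_{X'} ∘ J_S = Φ_X`).  Nothing here is a claim of PerL/QW8;
nothing is cited as a fact.

References: [Folland1989] G. B. Folland, *Harmonic Analysis in Phase Space*, Princeton UP 1989, Prop. (1.43), Prop. (1.50), (4.24);
[Weil1964] A. Weil, Acta Math. 111 (1964), Chap. III n° 37–38.
-/

set_option autoImplicit false

noncomputable section

open scoped Matrix Classical Kronecker SchwartzMap TensorProduct
open NumberField NumberField.InfinitePlace NumberField.mixedEmbedding IsDedekindDomain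
open Literature.NumberTheory.Automorphic Literature.NumberTheory.Automorphic.UnitaryGroup
open Literature.RepresentationTheory.HeisenbergGroup
open Literature.NumberTheory.Weil1964 Literature.NumberTheory.GelbartRogawski1991 Literature.NumberTheory.GelbartRogawski1991.UnitaryDualPair
open HodgeCM.PerL34 HodgeCM.Model.HypCensus HodgeCM.Model.ArchSideTerm

namespace HodgeCM.Model.ArchLevi

/-! ## §6 (VT) from period-1's (STRIP) output, product currency `Fin 3 × Fin (1 + 1)` -/

section FromStrip

variable {L : CMField} {ι₁ : L →+* ℂ} (V : HermSpace3 L ι₁) (S : StubTree.SeesawDatum L)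
variable {TW' : Matrix (Fin 2) (Fin 2) (↥(maximalRealSubfield (L : Type)))} (hW' : TW'.IsSymm)
  {JW' : Matrix (Fin 2) (Fin 2) (L : Type)} (hJW' : JW' = TW'.map (algebraMap (↥(maximalRealSubfield (L : Type))) (L : Type)))
  (hg : (((Literature.NumberTheory.Automorphic.toAdeleGL (L : Type) S.isoGL : GL (Fin 2) (AdeleRing (𝓞 (L : Type)) (L : Type))) : Matrix (Fin 2) (Fin 2) (AdeleRing (𝓞 (L : Type)) (L : Type))).map
        (conjAdele (↥(maximalRealSubfield (L : Type))) (L : Type) (IsCMField.complexConj (L : Type))))ᵀ *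
      UnitaryGroup.adelicForm (L : Type) 2 (Matrix.diagonal (dW S)) *
      (Literature.NumberTheory.Automorphic.toAdeleGL (L : Type) S.isoGL : GL (Fin 2) (AdeleRing (𝓞 (L : Type)) (L : Type))) =
    UnitaryGroup.adelicForm (L : Type) 2 JW')
  (C : GL (Fin 3 × Fin 2) (AdeleRing (𝓞 (↥(maximalRealSubfield (L : Type)))) (↥(maximalRealSubfield (L : Type)))))
  (hC : (realDiagonal (L : Type) (frameD V) (frameD_real V)).map (algebraMap (↥(maximalRealSubfield (L : Type))) (AdeleRing (𝓞 (↥(maximalRealSubfield (L : Type)))) (↥(maximalRealSubfield (L : Type))))) ⊗ₖ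
        (realDiagonal (L : Type) (dW S) (dW_real S)).map (algebraMap (↥(maximalRealSubfield (L : Type))) (AdeleRing (𝓞 (↥(maximalRealSubfield (L : Type)))) (↥(maximalRealSubfield (L : Type))))) * (C : Matrix (Fin 3 × Fin 2) (Fin 3 × Fin 2) (AdeleRing (𝓞 (↥(maximalRealSubfield (L : Type)))) (↥(maximalRealSubfield (L : Type))))) =
      (realDiagonal (L : Type) (frameD V) (frameD_real V)).map (algebraMap (↥(maximalRealSubfield (L : Type))) (AdeleRing (𝓞 (↥(maximalRealSubfield (L : Type)))) (↥(maximalRealSubfield (L : Type))))) ⊗ₖ TW'.map (algebraMap (↥(maximalRealSubfield (L : Type))) (AdeleRing (𝓞 (↥(maximalRealSubfield (L : Type)))) (↥(maximalRealSubfield (L : Type))))))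

/-- the see-saw element of record transported to the `Fin (3·2)` currency is `conjSeesawSp`, transported. [folklore] -/
theorem proj_reindex_cmConjSeesawMp :
    adelicMpCont.proj (↥(maximalRealSubfield (L : Type))) (Fin (3 * 2)) _
        (adelicMpContReindex (↥(maximalRealSubfield (L : Type))) (finProdFinEquiv : Fin 3 × Fin (1 + 1) ≃ Fin (3 * 2))
          (cmProdGram (L : Type) (frameD V) (frameD_real V) (dW S) (dW_real S))
          (cmConjSeesawMp (L : Type) (frameD V) (frameD_real V) (frameD_ne V) (dW S) (dW_real S) (dW_ne S)
            (dW' S) (dW'_real S) (dW'_ne S) S.isoGL (isoGL_hg₀ S))) =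
      UnitaryGroup.spReindex finProdFinEquiv (cmProdGramVS V S)
        (conjSeesawSp V S
          (isSymm_finSum (realDiagonal_isSymm (L : Type) (lineVec (L : Type) (dW' S 0)) fun _ => dW'_real S 0)
            (realDiagonal_isSymm (L : Type) (lineVec (L : Type) (dW' S 1)) fun _ => dW'_real S 1))
          (finSum_eq_map_finSum (↥(maximalRealSubfield (L : Type))) (L : Type) 1 1 (Matrix.diagonal (lineVec (L : Type) (dW' S 0))) (Matrix.diagonal (lineVec (L : Type) (dW' S 1)))
            (realDiagonal_map (L : Type) (lineVec (L : Type) (dW' S 0)) fun _ => dW'_real S 0).symm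
            (realDiagonal_map (L : Type) (lineVec (L : Type) (dW' S 1)) fun _ => dW'_real S 1).symm)
          (adelicIsometry_conj (L : Type) (dW S) (dW' S) S.isoGL (isoGL_hg₀ S))
          (gramConj (L : Type) (N := 3) (dW S) (dW_real S) (dW_ne S) (dW' S) (dW'_real S) (dW'_ne S))
          (gramIntertwiner_conj (L : Type) (dW S) (dW_real S) (dW_ne S) (dW' S) (dW'_real S) (dW'_ne S)
            (realDiagonal (L : Type) (frameD V) (frameD_real V)))) := by
  have h1 := adelicMpCont.proj_reindex (↥(maximalRealSubfield (L : Type))) (finProdFinEquiv : Fin 3 × Fin (1 + 1) ≃ Fin (3 * 2))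
    (cmProdGram (L : Type) (frameD V) (frameD_real V) (dW S) (dW_real S))
    (cmConjSeesawMp (L : Type) (frameD V) (frameD_real V) (frameD_ne V) (dW S) (dW_real S) (dW_ne S)
      (dW' S) (dW'_real S) (dW'_ne S) S.isoGL (isoGL_hg₀ S))
  exact h1.trans (congrArg _ ((proj_cmConjSeesawMp (L : Type) (frameD V) (frameD_real V) (frameD_ne V) (dW S) (dW_real S) (dW_ne S)
    (dW' S) (dW'_real S) (dW'_ne S) S.isoGL (isoGL_hg₀ S)).trans (seesawElement_eq_conjSeesawSp V S)))

/-- **(VT) FROM A (STRIP) DECOMPOSITION, `Fin 3 × Fin 2` currency**: for ANY `p ∈ Mp_ψ(W_{T_V ⊗ T_W})ᶜᵒⁿᵗ` over the see-saw element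
(`π p = conjSeesawSp …`) with tensor decomposition `ω(p)(E(Φ ⊗ f)) = E(A Φ ⊗ M_f f)` on `𝒮(𝔸^{3 × 2})`, the reindexed archimedean factor is
`R_e (A Φ) = c • ω_∞(1, k) ((R_e Φ) ∘ J_S)`.  (Period-1's `cmConjSeesawMp` is such a `p`, typed at `Fin 3 × Fin (1 + 1)`: cast by `Fin (1+1) = Fin 2`.)
[cite: Folland1989, Prop. (1.43), Prop. (1.50), (4.24)] -/
theorem exists_reindex_archFactor_eq_smul_cmArchWeilRep_conj
    (hGR : (cmSplittingDatum (L : Type) finProdFinEquiv (frameD V) (frameD_real V) (frameD_ne V) (dW S) (dW_real S) (dW_ne S)).CompatibleSplitting)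
    (p : adelicMpCont (↥(maximalRealSubfield (L : Type))) (Fin 3 × Fin 2) (cmProdGramVS V S))
    (hp : adelicMpCont.proj (↥(maximalRealSubfield (L : Type))) (Fin 3 × Fin 2) (cmProdGramVS V S) p = conjSeesawSp V S hW' hJW' hg C hC)
    (A : 𝓢((Fin 3 × Fin 2 → mixedSpace (↥(maximalRealSubfield (L : Type)))), ℂ) →L[ℂ] 𝓢((Fin 3 × Fin 2 → mixedSpace (↥(maximalRealSubfield (L : Type)))), ℂ))
    (Mf : FinSB (↥(maximalRealSubfield (L : Type))) (Fin 3 × Fin 2) ≃ₗ[ℂ] FinSB (↥(maximalRealSubfield (L : Type))) (Fin 3 × Fin 2))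
    (hAM : ∀ (Φ : 𝓢((Fin 3 × Fin 2 → mixedSpace (↥(maximalRealSubfield (L : Type)))), ℂ)) (f : FinSB (↥(maximalRealSubfield (L : Type))) (Fin 3 × Fin 2)),
      adelicMpCont.omega (↥(maximalRealSubfield (L : Type))) (Fin 3 × Fin 2) (cmProdGramVS V S) p (piSchwartzBruhatEquiv (↥(maximalRealSubfield (L : Type))) (Fin 3 × Fin 2) (Φ ⊗ₜ f)) =
        piSchwartzBruhatEquiv (↥(maximalRealSubfield (L : Type))) (Fin 3 × Fin 2) (A Φ ⊗ₜ Mf f)) :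
    ∃ c : ℂ, ∀ Φ : 𝓢((Fin 3 × Fin 2 → mixedSpace (↥(maximalRealSubfield (L : Type)))), ℂ),
      schwartzReindexCLM (↥(maximalRealSubfield (L : Type))) (finProdFinEquiv : Fin 3 × Fin 2 ≃ Fin (3 * 2)) (A Φ) =
        c • cmArchWeilRep (L : Type) finProdFinEquiv (frameD V) (frameD_real V) (frameD_ne V) (dW S) (dW_real S) (dW_ne S) hGR
          (1, conjTransportK S)
          (SchwartzMap.compCLMOfContinuousLinearEquiv ℂ (conjFrameTransport V S)
            (schwartzReindexCLM (↥(maximalRealSubfield (L : Type))) (finProdFinEquiv : Fin 3 × Fin 2 ≃ Fin (3 * 2)) Φ)) := by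
  -- transported tensor factors
  have h2 : ∀ (Φ : 𝓢((Fin (3 * 2) → mixedSpace (↥(maximalRealSubfield (L : Type)))), ℂ)) (f : FinSB (↥(maximalRealSubfield (L : Type))) (Fin (3 * 2))),
      (piSBReindex (↥(maximalRealSubfield (L : Type))) (finProdFinEquiv : Fin 3 × Fin 2 ≃ Fin (3 * 2))).symm (piSchwartzBruhatEquiv (↥(maximalRealSubfield (L : Type))) (Fin (3 * 2)) (Φ ⊗ₜ f)) =
        piSchwartzBruhatEquiv (↥(maximalRealSubfield (L : Type))) (Fin 3 × Fin 2)
          (schwartzReindexCLM (↥(maximalRealSubfield (L : Type))) (finProdFinEquiv : Fin 3 × Fin 2 ≃ Fin (3 * 2)).symm Φ ⊗ₜ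
            finSBReindex (↥(maximalRealSubfield (L : Type))) (finProdFinEquiv : Fin 3 × Fin 2 ≃ Fin (3 * 2)).symm f) :=
    fun Φ f => piSBReindex_tmul (↥(maximalRealSubfield (L : Type))) (finProdFinEquiv : Fin 3 × Fin 2 ≃ Fin (3 * 2)).symm Φ f
  have h3 : ∀ (Φ : 𝓢((Fin 3 × Fin 2 → mixedSpace (↥(maximalRealSubfield (L : Type)))), ℂ)) (f : FinSB (↥(maximalRealSubfield (L : Type))) (Fin 3 × Fin 2)),
      piSBReindex (↥(maximalRealSubfield (L : Type))) (finProdFinEquiv : Fin 3 × Fin 2 ≃ Fin (3 * 2)) (piSchwartzBruhatEquiv (↥(maximalRealSubfield (L : Type))) (Fin 3 × Fin 2) (Φ ⊗ₜ f)) =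
        piSchwartzBruhatEquiv (↥(maximalRealSubfield (L : Type))) (Fin (3 * 2))
          (schwartzReindexCLM (↥(maximalRealSubfield (L : Type))) (finProdFinEquiv : Fin 3 × Fin 2 ≃ Fin (3 * 2)) Φ ⊗ₜ
            finSBReindex (↥(maximalRealSubfield (L : Type))) (finProdFinEquiv : Fin 3 × Fin 2 ≃ Fin (3 * 2)) f) :=
    fun Φ f => piSBReindex_tmul (↥(maximalRealSubfield (L : Type))) (finProdFinEquiv : Fin 3 × Fin 2 ≃ Fin (3 * 2)) Φ f
  have hAM' : ∀ (Φ : 𝓢((Fin (3 * 2) → mixedSpace (↥(maximalRealSubfield (L : Type)))), ℂ)) (f : FinSB (↥(maximalRealSubfield (L : Type))) (Fin (3 * 2))),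
      adelicMpCont.omega (↥(maximalRealSubfield (L : Type))) (Fin (3 * 2)) _ (adelicMpContReindex (↥(maximalRealSubfield (L : Type))) (finProdFinEquiv : Fin 3 × Fin 2 ≃ Fin (3 * 2)) (cmProdGramVS V S) p)
          (piSchwartzBruhatEquiv (↥(maximalRealSubfield (L : Type))) (Fin (3 * 2)) (Φ ⊗ₜ f)) =
        piSchwartzBruhatEquiv (↥(maximalRealSubfield (L : Type))) (Fin (3 * 2))
          (((schwartzReindexCLM (↥(maximalRealSubfield (L : Type))) (finProdFinEquiv : Fin 3 × Fin 2 ≃ Fin (3 * 2))).comp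
              (A.comp (schwartzReindexCLM (↥(maximalRealSubfield (L : Type))) (finProdFinEquiv : Fin 3 × Fin 2 ≃ Fin (3 * 2)).symm))) Φ ⊗ₜ
            ((finSBReindex (↥(maximalRealSubfield (L : Type))) (finProdFinEquiv : Fin 3 × Fin 2 ≃ Fin (3 * 2))).toLinearMap ∘ₗ
              (Mf : FinSB (↥(maximalRealSubfield (L : Type))) (Fin 3 × Fin 2) →ₗ[ℂ] FinSB (↥(maximalRealSubfield (L : Type))) (Fin 3 × Fin 2)) ∘ₗ
              (finSBReindex (↥(maximalRealSubfield (L : Type))) (finProdFinEquiv : Fin 3 × Fin 2 ≃ Fin (3 * 2)).symm).toLinearMap) f) := by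
    intro Φ f
    exact (adelicMpCont.omega_reindex_apply _ _ _ _ _).trans
      ((congrArg (piSBReindex (↥(maximalRealSubfield (L : Type))) (finProdFinEquiv : Fin 3 × Fin 2 ≃ Fin (3 * 2)))
        ((congrArg (adelicMpCont.omega (↥(maximalRealSubfield (L : Type))) (Fin 3 × Fin 2) (cmProdGramVS V S) p) (h2 Φ f)).trans (hAM _ _))).trans (h3 _ _))
  -- a finite test vector on which the transported `M_f` does not vanish
  have hf₀ : ((finSBReindex (↥(maximalRealSubfield (L : Type))) (finProdFinEquiv : Fin 3 × Fin 2 ≃ Fin (3 * 2))).toLinearMap ∘ₗ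
        (Mf : FinSB (↥(maximalRealSubfield (L : Type))) (Fin 3 × Fin 2) →ₗ[ℂ] FinSB (↥(maximalRealSubfield (L : Type))) (Fin 3 × Fin 2)) ∘ₗ
        (finSBReindex (↥(maximalRealSubfield (L : Type))) (finProdFinEquiv : Fin 3 × Fin 2 ≃ Fin (3 * 2)).symm).toLinearMap)
      (finSBReindex (↥(maximalRealSubfield (L : Type))) (finProdFinEquiv : Fin 3 × Fin 2 ≃ Fin (3 * 2))
        (indicatorSB (↥(maximalRealSubfield (L : Type))) (Fin 3 × Fin 2) (piLevelIdeal (↥(maximalRealSubfield (L : Type))) (Fin 3 × Fin 2) ⊤) (isOpen_piLevelIdeal (↥(maximalRealSubfield (L : Type))) ⊤)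
          (isCompact_piLevelIdeal (↥(maximalRealSubfield (L : Type))) (Fin 3 × Fin 2) ⊤))) ≠ 0 := by
    intro h
    have h1 : finSBReindex (↥(maximalRealSubfield (L : Type))) (finProdFinEquiv : Fin 3 × Fin 2 ≃ Fin (3 * 2)).symm
        (finSBReindex (↥(maximalRealSubfield (L : Type))) (finProdFinEquiv : Fin 3 × Fin 2 ≃ Fin (3 * 2))
          (indicatorSB (↥(maximalRealSubfield (L : Type))) (Fin 3 × Fin 2) (piLevelIdeal (↥(maximalRealSubfield (L : Type))) (Fin 3 × Fin 2) ⊤) (isOpen_piLevelIdeal (↥(maximalRealSubfield (L : Type))) ⊤)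
            (isCompact_piLevelIdeal (↥(maximalRealSubfield (L : Type))) (Fin 3 × Fin 2) ⊤))) =
        indicatorSB (↥(maximalRealSubfield (L : Type))) (Fin 3 × Fin 2) (piLevelIdeal (↥(maximalRealSubfield (L : Type))) (Fin 3 × Fin 2) ⊤) (isOpen_piLevelIdeal (↥(maximalRealSubfield (L : Type))) ⊤)
          (isCompact_piLevelIdeal (↥(maximalRealSubfield (L : Type))) (Fin 3 × Fin 2) ⊤) :=
      Subtype.ext (funext fun a => by
        simp only [coe_finSBReindex_apply]
        rw [Function.comp_assoc, Equiv.symm_comp_self, Function.comp_id])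
    simp only [LinearMap.comp_apply, LinearEquiv.coe_coe, h1, LinearEquiv.map_eq_zero_iff] at h
    exact id_indicatorSB_top_ne_zero (F := (↥(maximalRealSubfield (L : Type)))) (ι := Fin 3 × Fin 2) (by rw [LinearMap.id_apply]; exact h)
  have hh₀ : adelicMpCont.proj (↥(maximalRealSubfield (L : Type))) (Fin (3 * 2)) _
      (adelicMpContReindex (↥(maximalRealSubfield (L : Type))) (finProdFinEquiv : Fin 3 × Fin 2 ≃ Fin (3 * 2)) (cmProdGramVS V S) p) =
      UnitaryGroup.spReindex finProdFinEquiv (cmProdGramVS V S) (conjSeesawSp V S hW' hJW' hg C hC) :=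
    (adelicMpCont.proj_reindex _ _ _ _).trans (congrArg _ hp)
  obtain ⟨c, hc⟩ := exists_archFactor_eq_smul_cmArchWeilRep_conj V S hW' hJW' hg C hC hGR _ hh₀ _
    (implements_adelicMpCont_proj (adelicMpContReindex (↥(maximalRealSubfield (L : Type))) (finProdFinEquiv : Fin 3 × Fin 2 ≃ Fin (3 * 2)) (cmProdGramVS V S) p))
    _ _ (fun Φ f => (adelicMpCont_omega_apply_eq _ _).symm.trans (hAM' Φ f)) hf₀
  refine ⟨c, fun Φ => ?_⟩
  have hback : schwartzReindexCLM (↥(maximalRealSubfield (L : Type))) (finProdFinEquiv : Fin 3 × Fin 2 ≃ Fin (3 * 2)).symm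
      (schwartzReindexCLM (↥(maximalRealSubfield (L : Type))) (finProdFinEquiv : Fin 3 × Fin 2 ≃ Fin (3 * 2)) Φ) = Φ := by
    ext x
    simp only [schwartzReindexCLM_apply]
    rw [Function.comp_assoc, Equiv.symm_comp_self, Function.comp_id]
  exact (congrArg (fun Ψ => schwartzReindexCLM (↥(maximalRealSubfield (L : Type))) (finProdFinEquiv : Fin 3 × Fin 2 ≃ Fin (3 * 2)) (A Ψ)) hback).symm.trans
    (hc (schwartzReindexCLM (↥(maximalRealSubfield (L : Type))) (finProdFinEquiv : Fin 3 × Fin 2 ≃ Fin (3 * 2)) Φ))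

end FromStrip

/-! ## §7 period-1's `cmConjSeesawMp` verbatim (`Fin 3 × Fin (1 + 1)` currency) -/

section Wrapper

variable {L : CMField} {ι₁ : L →+* ℂ} (V : HermSpace3 L ι₁) (S : StubTree.SeesawDatum L)

/-- period-1's `cmConjSeesawMp` at the see-saw data of `S`, read at the `Fin 3 × Fin 2` type (`Fin (1 + 1) = Fin 2`). -/
abbrev conjSeesawMp : adelicMpCont (↥(maximalRealSubfield (L : Type))) (Fin 3 × Fin 2) (cmProdGramVS V S) :=
  cmConjSeesawMp (L : Type) (frameD V) (frameD_real V) (frameD_ne V) (dW S) (dW_real S) (dW_ne S)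
    (dW' S) (dW'_real S) (dW'_ne S) S.isoGL (isoGL_hg₀ S)

/-- its symplectic component is `conjSeesawSp` at the (34)-currency data of record. -/
theorem proj_conjSeesawMp :
    adelicMpCont.proj (↥(maximalRealSubfield (L : Type))) (Fin 3 × Fin 2) (cmProdGramVS V S) (conjSeesawMp V S) =
      conjSeesawSp V S
        (isSymm_finSum (realDiagonal_isSymm (L : Type) (lineVec (L : Type) (dW' S 0)) fun _ => dW'_real S 0)
          (realDiagonal_isSymm (L : Type) (lineVec (L : Type) (dW' S 1)) fun _ => dW'_real S 1))
        (finSum_eq_map_finSum (↥(maximalRealSubfield (L : Type))) (L : Type) 1 1 (Matrix.diagonal (lineVec (L : Type) (dW' S 0))) (Matrix.diagonal (lineVec (L : Type) (dW' S 1)))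
          (realDiagonal_map (L : Type) (lineVec (L : Type) (dW' S 0)) fun _ => dW'_real S 0).symm
          (realDiagonal_map (L : Type) (lineVec (L : Type) (dW' S 1)) fun _ => dW'_real S 1).symm)
        (adelicIsometry_conj (L : Type) (dW S) (dW' S) S.isoGL (isoGL_hg₀ S))
        (gramConj (L : Type) (N := 3) (dW S) (dW_real S) (dW_ne S) (dW' S) (dW'_real S) (dW'_ne S))
        (gramIntertwiner_conj (L : Type) (dW S) (dW_real S) (dW_ne S) (dW' S) (dW'_real S) (dW'_ne S)
          (realDiagonal (L : Type) (frameD V) (frameD_real V))) :=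
  (proj_cmConjSeesawMp (L : Type) (frameD V) (frameD_real V) (frameD_ne V) (dW S) (dW_real S) (dW_ne S)
    (dW' S) (dW'_real S) (dW'_ne S) S.isoGL (isoGL_hg₀ S)).trans (seesawElement_eq_conjSeesawSp V S)

/-- **(VT) FROM PERIOD-1'S (STRIP), VERBATIM CURRENCY**: clause 2 of `ArchConjSlotStrip.exists_cmConjLineTensorFin_testFun_eq_tmul` (the tensor
decomposition `(A, M_f)` of `ω(r_F h₀)` on `𝒮(𝔸^{3 × (1+1)})`) ⟹ `R_e (A Φ) = c • ω_∞(1, k) ((R_e Φ) ∘ J_S)` for one scalar `c` and all `Φ`.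
With `Φ :=` the raw primed box (`slotArchBox_eq`: `R_e` of it is `Φ_{X'}`) and (K9) `compCLM_conjFrameTransport_slotArchBox_linePhi`
(`Φ_{X'} ∘ J_S = Φ_X`) this is #1218's `hY` with `a := c`. [cite: Folland1989, Prop. (1.43), Prop. (1.50), (4.24)] -/
theorem exists_reindex_archFactor_eq_smul_cmArchWeilRep_cmConjSeesawMp
    (hGR : (cmSplittingDatum (L : Type) finProdFinEquiv (frameD V) (frameD_real V) (frameD_ne V) (dW S) (dW_real S) (dW_ne S)).CompatibleSplitting)
    (A : 𝓢((Fin 3 × Fin (1 + 1) → mixedSpace (↥(maximalRealSubfield (L : Type)))), ℂ) ≃L[ℂ] 𝓢((Fin 3 × Fin (1 + 1) → mixedSpace (↥(maximalRealSubfield (L : Type)))), ℂ))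
    (Mf : FinSB (↥(maximalRealSubfield (L : Type))) (Fin 3 × Fin (1 + 1)) ≃ₗ[ℂ] FinSB (↥(maximalRealSubfield (L : Type))) (Fin 3 × Fin (1 + 1)))
    (hAM : ∀ (Φ : 𝓢((Fin 3 × Fin (1 + 1) → mixedSpace (↥(maximalRealSubfield (L : Type)))), ℂ)) (f : FinSB (↥(maximalRealSubfield (L : Type))) (Fin 3 × Fin (1 + 1))),
      adelicMpCont.omega (↥(maximalRealSubfield (L : Type))) (Fin 3 × Fin (1 + 1)) (cmProdGram (L : Type) (frameD V) (frameD_real V) (dW S) (dW_real S))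
          (cmConjSeesawMp (L : Type) (frameD V) (frameD_real V) (frameD_ne V) (dW S) (dW_real S) (dW_ne S)
            (dW' S) (dW'_real S) (dW'_ne S) S.isoGL (isoGL_hg₀ S))
          (piSchwartzBruhatEquiv (↥(maximalRealSubfield (L : Type))) (Fin 3 × Fin (1 + 1)) (Φ ⊗ₜ f)) =
        piSchwartzBruhatEquiv (↥(maximalRealSubfield (L : Type))) (Fin 3 × Fin (1 + 1)) (A Φ ⊗ₜ Mf f)) :
    ∃ c : ℂ, ∀ Φ : 𝓢((Fin 3 × Fin 2 → mixedSpace (↥(maximalRealSubfield (L : Type)))), ℂ),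
      schwartzReindexCLM (↥(maximalRealSubfield (L : Type))) (finProdFinEquiv : Fin 3 × Fin 2 ≃ Fin (3 * 2)) (A Φ) =
        c • cmArchWeilRep (L : Type) finProdFinEquiv (frameD V) (frameD_real V) (frameD_ne V) (dW S) (dW_real S) (dW_ne S) hGR
          (1, conjTransportK S)
          (SchwartzMap.compCLMOfContinuousLinearEquiv ℂ (conjFrameTransport V S)
            (schwartzReindexCLM (↥(maximalRealSubfield (L : Type))) (finProdFinEquiv : Fin 3 × Fin 2 ≃ Fin (3 * 2)) Φ)) :=
  exists_reindex_archFactor_eq_smul_cmArchWeilRep_conj V S _ _ _ _ _ hGR (conjSeesawMp V S) (proj_conjSeesawMp V S)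
    (A : 𝓢((Fin 3 × Fin 2 → mixedSpace (↥(maximalRealSubfield (L : Type)))), ℂ) →L[ℂ] 𝓢((Fin 3 × Fin 2 → mixedSpace (↥(maximalRealSubfield (L : Type)))), ℂ)) Mf hAM

end Wrapper

end HodgeCM.Model.ArchLevi

end
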